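import Summits.Ventures.PercRepro.RankLevelSetTelForm

/-!
# PercRepro — THE TELESCOPING FORM WITH THE NULLITY SPLIT: the `N`-side `nsideTel2` (p8, gen 21; a feeder for S4 — the
top of the `q = 7` window, the rows `52` and below)

THE SPLIT. Either some set `X` of rank `≤ 7` carries the whole nullity (`|X| = r(X) + d`) — then every element outside `X`
is a coloop (`M ＼ {y}` would have nullity `d − 1 < ν(X)`), every spanning `A` contains `E ∖ X`, and
`#U(p, 7) ≤ 2^{|X|} ≤ 2^{7 + d}` — or EVERY set of rank `≤ 7` has at most `r(X) + d − 1` points: then the telescoping count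
(S2TelescopeCount) runs with the flat caps `f = min 79 (6 + d)`, `f' = min 39 (5 + d)` in place of `min 79 (7 + d)`,
`min 39 (6 + d)`, i.e. with the closure cap `F = min (f − 8) (ν₁ − 2)` one smaller and the powerset term `2^{min 79 (6 + d)}`.
At `(55, 13)` the count drops from `0.888` to `0.667` of the budget; the rows `52 … 48` close on it with the bootstrapped
triangle count and p1's T4⁺ (work/tools/price_split.py).
* **`ThmN.nsideTel2 p d S3 S4 S5`** — `C(n, 7) + Σ_{j < d − 7} Λ(j + 1) + 2^{min 79 (6 + d)}`, `Λ = lamTel (C(n, 7)) Π′ F ρ` with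
  `F = min (min 79 (6 + d) − 8) (ν₁ − 2)`, the same `Π′` (the disjoint pair count with `S3, S4, S5`) and `ρ(ν) = ν + r_min(ν)`
  as `nsideTel` (RankLevelSetTelForm);
* `S2.lamTel_nonneg`, `nsideTel_nonneg`, `two_pow_le_nsideTel`, `nsideTel2_nonneg` — the positivity facts the split core uses
  (`2^{min 79 (7 + d)} ≤ nsideTel`, so that the coloop case `#U ≤ 2^{7 + d}` (`d ≤ 72`) sits under either form).
Axioms: standard.
-/

namespace PercRepro

namespace S2

/-- `lamTel c P F ρ ν ≥ 0` for `c, P ≥ 0`. -/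
theorem lamTel_nonneg {c P : ℚ} (hc : 0 ≤ c) (hP : 0 ≤ P) (F : ℕ) (ρ : ℕ → ℕ) (ν : ℕ) :
    0 ≤ lamTel c P F ρ ν := by
  induction ν with
  | zero => rw [lamTel_zero]; exact hc
  | succ ν ih =>
    rw [lamTel_succ]
    apply le_min
    · apply div_nonneg (mul_nonneg hP (Nat.cast_nonneg _)) (Nat.cast_nonneg _)
    · exact mul_nonneg ih (div_nonneg (Nat.cast_nonneg _) (Nat.cast_nonneg _))

end S2

namespace ThmN

/-- `nsideTel p d S3 S4 S5 ≥ 0`. -/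
theorem nsideTel_nonneg (p d S3 S4 S5 : ℕ) : 0 ≤ nsideTel p d S3 S4 S5 := by
  unfold nsideTel
  refine add_nonneg (add_nonneg (Nat.cast_nonneg _) (Finset.sum_nonneg fun j _ => ?_)) (by positivity)
  exact S2.lamTel_nonneg (Nat.cast_nonneg _) (by positivity) _ _ _

/-- `2^{min 79 (7 + d)} ≤ nsideTel p d S3 S4 S5`. -/
theorem two_pow_le_nsideTel (p d S3 S4 S5 : ℕ) : (2 : ℚ) ^ (min 79 (7 + d)) ≤ nsideTel p d S3 S4 S5 := by
  unfold nsideTel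
  have h1 : (0 : ℚ) ≤ (((p + d).choose 7 : ℕ) : ℚ) := Nat.cast_nonneg _
  have h2 : (0 : ℚ) ≤ ∑ j ∈ Finset.range (d - 7), S2.lamTel (((p + d).choose 7 : ℕ) : ℚ)
      (((S3 : ℕ) : ℚ) * (((p + d - 3).choose 5 : ℕ) : ℚ) + ((S4 : ℕ) : ℚ) * (((p + d - 4).choose 4 : ℕ) : ℚ) +
        ((S5 : ℕ) : ℚ) * (((p + d - 5).choose 3 : ℕ) : ℚ) +
        (((d + 5).choose 6 : ℕ) : ℚ) * (((p + d - 6).choose 2 : ℕ) : ℚ) +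
        (((d + 6).choose 7 : ℕ) : ℚ) * (((p + d - 7 : ℕ)) : ℚ) + (((d + 7).choose 8 : ℕ) : ℚ))
      (min 71 (max ((d + min 33 d) / 2 + 1) (min 32 (d - 1) + 2) - 2)) (fun ν => ν + S2.rminF ν) (j + 1) :=
    Finset.sum_nonneg fun j _ => S2.lamTel_nonneg (Nat.cast_nonneg _) (by positivity) _ _ _
  linarith

/-- **The `N`-side of the telescoping count at level `7` in the split case** (every set of rank `≤ 7` has `≤ r + d − 1`
points): `C(n, 7) + Σ_{j < d − 7} Λ(j + 1) + 2^{min 79 (6 + d)}` with the closure cap `F = min (min 79 (6 + d) − 8) (ν₁ − 2)`. -/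
def nsideTel2 (p d S3 S4 S5 : ℕ) : ℚ :=
  (((p + d).choose 7 : ℕ) : ℚ) +
    (∑ j ∈ Finset.range (d - 7), S2.lamTel (((p + d).choose 7 : ℕ) : ℚ)
      (((S3 : ℕ) : ℚ) * (((p + d - 3).choose 5 : ℕ) : ℚ) + ((S4 : ℕ) : ℚ) * (((p + d - 4).choose 4 : ℕ) : ℚ) +
        ((S5 : ℕ) : ℚ) * (((p + d - 5).choose 3 : ℕ) : ℚ) +
        (((d + 5).choose 6 : ℕ) : ℚ) * (((p + d - 6).choose 2 : ℕ) : ℚ) +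
        (((d + 6).choose 7 : ℕ) : ℚ) * (((p + d - 7 : ℕ)) : ℚ) + (((d + 7).choose 8 : ℕ) : ℚ))
      (min (min 79 (6 + d) - 8) (max ((d + min 33 d) / 2 + 1) (min 32 (d - 1) + 2) - 2))
      (fun ν => ν + S2.rminF ν) (j + 1)) +
    (2 : ℚ) ^ (min 79 (6 + d))

/-- `nsideTel2 p d S3 S4 S5 ≥ 0`. -/
theorem nsideTel2_nonneg (p d S3 S4 S5 : ℕ) : 0 ≤ nsideTel2 p d S3 S4 S5 := by
  unfold nsideTel2
  refine add_nonneg (add_nonneg (Nat.cast_nonneg _) (Finset.sum_nonneg fun j _ => ?_)) (by positivity)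
  exact S2.lamTel_nonneg (Nat.cast_nonneg _) (by positivity) _ _ _

end ThmN

end PercRepro
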